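/-
Copyright (c) 2026 the pub-hodgecm-mathlib formalisation cell (harness21).  Prover seat hodgecm-mathlib-F0P3-p04 (g12); architect A-p16 (g30) A-130 (2) ∕ A-135 (R1):
the EXPLICIT non-norm twist of a type-(2) element near the identity (rider `stub_twoDeepRep_typeTwo`, END fold v3.2 :320), 2026-09-01.
-/
import Mathlib.Data.Matrix.Basic
import Mathlib.LinearAlgebra.Matrix.Notation
import Mathlib.LinearAlgebra.Matrix.Trace
import Mathlib.Data.Matrix.Reflection
import Mathlib.Tactic.LinearCombination
import Mathlib.Tactic.FinCases
import Mathlib.Tactic.Ring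
import HarnessLib

/-!
# The explicit non-norm twist of a type-(2) unitary element in the cyclic frame of its `⋆`-fixed square-root generator
# (Rogawski 1990, §3.5 Prop. 3.5.2 (c), §3.6; Flicker 1998, §6)

Topic `NumberTheory/Rogawski1990`; namespace `Literature.NumberTheory.Rogawski1990`.  THEOREMS ONLY (no `def`, no instance, no notation, no named fact, no `sorry`);
generic algebra over a field `K` with a ring endomorphism `σ` (the involution of a quadratic extension); kernel lane `--supports stmt-HodgeConjecture-24833`.  Cell
`pub/hodgecm-mathlib`, crux H413, road «S3-tree», LIFT rider (H2D) `stub_twoDeepRep_typeTwo` (architect A-p16 (g30) A-130 (2), A-135 (R1) «explicit κ = −1 representative»).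
HONEST LABEL: HC_CM is proved only modulo the cell's 2 remaining named inputs (hLiu418 24832, h413 24833) until rung 0 closes; this file is unconditional matrix algebra.

THE MATHEMATICS.  Let `E∕F` be a quadratic extension with involution `σ`, `Φ₂ = antidiag(1,1)`, `Φ₃ = antidiag(1,1,1)`, and `γ = ι(g, u) = (a 0 b; 0 u 0; c 0 d)` the endoscopic
pattern of `g = (a b; c d) ∈ U(Φ₂)`, `u ∈ E¹`, with `χ_g` irreducible over `E` (a TYPE (2) element: torus `K₁¹ × E¹`, `K₁ = E[g]` a quadratic field, stable class = TWO classes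
[Rogawski1990, §3.6; Prop. 3.5.2 (c)]).  The `⋆`-fixed part of `E[g]` is `F ⊕ F·Π` for a traceless `⋆`-fixed `Π = (p q; r −p)` with `Π² = D·1`, `D = p² + qr ∈ F`
(`σp = −p`, `σq = q`, `σr = r`; ★ `exists_nonscalar_hermStar_eq_sq_eq_smul`), and `g = φ₀ + φ₁Π`.  Unitarity of `g` is the pair of relations
  (R1) `σφ₀·φ₁ + σφ₁·φ₀ = 0`,   (R2) `σφ₀·φ₀ + D·σφ₁·φ₁ = 1`   (§1).
In the Π-CYCLIC FRAME `C = (e₀ | Πe₀) = (1 p; 0 r)` — a `Φ₂`-similitude with multiplier `r` — `g` reads `(φ₀ φ₁D; φ₁ φ₀)`; twisting the Gram matrix by the `⋆`-fixed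
centraliser element `a = ι(C Π′ C⁻¹ ∕ r, −D)` (`Π′ = (0 D; 1 0)`; CORNER `−D`) gives `Φ′ = diag(1, −D, D)`, for which `M = ⟨e_m + e₂, e₀, (e₂ − e_m)∕2D⟩` has Gram matrix EXACTLY `Φ₃`.
Transporting `γ` along `Y = B⁻¹C₃⁻¹` (`B` the basis of `M`) yields the LITERAL
  `t₋ = ((u+φ₀)∕2, φ₁∕2, (φ₀−u)∕4D; φ₁D, φ₀, φ₁∕2; D(φ₀−u), Dφ₁, (u+φ₀)∕2)`,
written below with explicit inverses `ι = 2⁻¹`, `Di = D⁻¹`, `ri = r⁻¹` (hypotheses `2ι = 1`, `D·Di = 1`, `r·ri = 1`) so that every identity is POLYNOMIAL.  This file proves: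
§2 `t₋ ∈ U(Φ₃)` from (R1), (R2), `σu·u = 1`; §3 `Y·γ = t₋·Y` with `Y·Y⁻¹ = Y⁻¹·Y = 1` explicit (so `t₋ ∼_st γ`); §4 the twisted Gram matrix `ᵗ(σY) Φ₃ Y = (1 0 −p∕r; 0 −D 0; p∕r 0 q∕r)`;
§5 **if `t₋` is `U(Φ₃)`-conjugate to `γ` then `−D = σ(y)·y` is a NORM** (the Cartan-corner argument of [Rogawski1990, Prop. 3.5.2 (a)]: a unitary conjugator is `Y·z` with
`z ∈ Z(γ) = ι(E[g], E)`, and the middle entry of `ᵗ(σ(Yz)) Φ₃ (Yz) = Φ₃` reads `−D·σ(z₁₁)z₁₁ = 1`).  At a non-split unramified place `D` has ODD order, so `−D` is not a norm and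
`t₋` represents the OTHER class of the stable class of `γ` (`κ = −1`); when `g, u ≡ 1 (ϖ³)` the literal `t₋` is integral and `≡ 1 (ϖ²)` — the sequel ★ `TwoDeepRepresentativesTypeTwo`.

## References
* [Rogawski1990] J. D. Rogawski, *Automorphic Representations of Unitary Groups in Three Variables*, Ann. of Math. Stud. 123 (1990), §3.1 p. 19, §3.5 Prop. 3.5.2 (a)(c) p. 29,
  §3.6 p. 31, §4.9 p. 55.
* [Flicker1998UnitaryFL] Y. Z. Flicker, *Elementary proof of the fundamental lemma for a unitary group*, Canad. J. Math. 50 (1998), Prop. 3 p. 78, §6 p. 97.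
* [Jacobowitz1962] R. Jacobowitz, *Hermitian forms over local fields*, Amer. J. Math. 84 (1962), §5, §7.
-/

set_option autoImplicit false

namespace Literature.NumberTheory.Rogawski1990

open Matrix

variable {K : Type*} [Field K] (σ : K →+* K)

/-! ## §1 The `⋆`-fixed square-root generator `Π = (p q; r −p)` and the two unitarity relations of `g = φ₀ + φ₁Π` -/

/-- **Shape of a traceless `⋆`-fixed generator.**  If `ᵗ(σΠ)·Φ₂ = Φ₂·Π` (`Π` is `Φ₂`-`⋆`-fixed) and `tr Π = 0` then `Π = (p q; r −p)` with `σp = −p`, `σq = q`, `σr = r`,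
and `Π² = D·1` reads `p² + qr = D`. [cite: Rogawski1990, §3.6 p. 31; §3.5 Prop. 3.5.2 (a) p. 29] -/
theorem sqrtGenerator_shape (P : Matrix (Fin 2) (Fin 2) K) (hPs : (P.map σ)ᵀ * !![(0 : K), 1; 1, 0] = !![(0 : K), 1; 1, 0] * P) (htr : P.trace = 0)
    {D : K} (hsq : P * P = D • (1 : Matrix (Fin 2) (Fin 2) K)) :
    σ (P 0 0) = -P 0 0 ∧ σ (P 0 1) = P 0 1 ∧ σ (P 1 0) = P 1 0 ∧ P 1 1 = -P 0 0 ∧ P 0 0 * P 0 0 + P 0 1 * P 1 0 = D := by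
  have h11 : P 1 1 = -P 0 0 := by
    rw [Matrix.trace_fin_two] at htr
    linear_combination htr
  have e00 := congrArg (fun M => M 0 0) hPs
  have e01 := congrArg (fun M => M 0 1) hPs
  have e11 := congrArg (fun M => M 1 1) hPs
  have s00 := congrArg (fun M => M 0 0) hsq
  simp [Matrix.mul_apply, Fin.sum_univ_two] at e00 e01 e11 s00
  rw [h11] at e01
  exact ⟨e01, e11, e00, h11, s00⟩

/-- **The two unitarity relations.**  For `Π = (p q; r −p)` as above with `r ≠ 0` and `g = φ₀ + φ₁Π = (φ₀+φ₁p, φ₁q; φ₁r, φ₀−φ₁p)` unitary for `Φ₂`: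
(R1) `σφ₀·φ₁ + σφ₁·φ₀ = 0` and (R2) `σφ₀·φ₀ + D·(σφ₁·φ₁) = 1` (the `(1,0)` entry of `ᵗ(σg)Φ₂g = Φ₂` is `r·(R1)`, the `(0,1)` entry is `(R2) − p·(R1)`).
[cite: Rogawski1990, §3.6 p. 31; §3.5 Prop. 3.5.2 (a) p. 29] -/
theorem typeTwo_relations_of_unitary {p q r D φ₀ φ₁ : K} (hp : σ p = -p) (hr : σ r = r) (hD : p * p + q * r = D) (hr0 : r ≠ 0)
    (hgu : ((!![φ₀ + φ₁ * p, φ₁ * q; φ₁ * r, φ₀ - φ₁ * p] : Matrix (Fin 2) (Fin 2) K).map σ)ᵀ * !![(0 : K), 1; 1, 0] *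
      !![φ₀ + φ₁ * p, φ₁ * q; φ₁ * r, φ₀ - φ₁ * p] = !![(0 : K), 1; 1, 0]) :
    σ φ₀ * φ₁ + σ φ₁ * φ₀ = 0 ∧ σ φ₀ * φ₀ + D * (σ φ₁ * φ₁) = 1 := by
  have e00 := congrArg (fun M => M 0 0) hgu
  have e01 := congrArg (fun M => M 0 1) hgu
  simp [Matrix.mul_apply, Fin.sum_univ_two, map_add, map_mul, hp, hr] at e00 e01
  have R1 : σ φ₀ * φ₁ + σ φ₁ * φ₀ = 0 := by
    have h : r * (σ φ₀ * φ₁ + σ φ₁ * φ₀) = 0 := by linear_combination e00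
    rcases mul_eq_zero.1 h with h | h
    · exact absurd h hr0
    · exact h
  refine ⟨R1, ?_⟩
  linear_combination e01 + p * R1 - σ φ₁ * φ₁ * hD

/-! ## §2 The literal `t₋` is unitary for `Φ₃` -/

/-- **`t₋ ∈ U(Φ₃)`**: with `2ι = 1`, `D·Di = 1`, `σ` fixing `D, ι, Di`, the relations (R1), (R2) and `σu·u = 1`, the literal
`t₋ = ((u+φ₀)ι, φ₁ι, (φ₀−u)ι²Di; φ₁D, φ₀, φ₁ι; D(φ₀−u), Dφ₁, (u+φ₀)ι)` satisfies `ᵗ(σ t₋) Φ₃ t₋ = Φ₃` (nine polynomial identities).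
[cite: Rogawski1990, §3.5 Prop. 3.5.2 (a)(c) p. 29; §3.6 p. 31] [cite: Jacobowitz1962, §5] -/
theorem twistRep_unitary {D ι Di φ₀ φ₁ u : K} (hι : 2 * ι = 1) (hDi : D * Di = 1) (hσD : σ D = D) (hσι : σ ι = ι) (hσDi : σ Di = Di)
    (R1 : σ φ₀ * φ₁ + σ φ₁ * φ₀ = 0) (R2 : σ φ₀ * φ₀ + D * (σ φ₁ * φ₁) = 1) (hu : σ u * u = 1) :
    ((!![(u + φ₀) * ι, φ₁ * ι, (φ₀ - u) * ι * ι * Di; φ₁ * D, φ₀, φ₁ * ι; D * (φ₀ - u), D * φ₁, (u + φ₀) * ι] : Matrix (Fin 3) (Fin 3) K).map σ)ᵀ *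
        !![(0 : K), 0, 1; 0, 1, 0; 1, 0, 0] * !![(u + φ₀) * ι, φ₁ * ι, (φ₀ - u) * ι * ι * Di; φ₁ * D, φ₀, φ₁ * ι; D * (φ₀ - u), D * φ₁, (u + φ₀) * ι] =
      !![(0 : K), 0, 1; 0, 1, 0; 1, 0, 0] := by
  ext i j
  fin_cases i <;> fin_cases j <;>
    simp [Matrix.mul_apply, Fin.sum_univ_three, map_add, map_sub, map_mul, hσD, hσι, hσDi]
  · linear_combination D * R2 - D * hu + D * (σ φ₀ * φ₀ - σ u * u) * hι
  · linear_combination D * R1 + D * (σ φ₀ * φ₁) * hι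
  · linear_combination (ι * ι * ((σ φ₀ - σ u) * (φ₀ - u))) * hDi + (ι * (σ u * u + σ φ₀ * φ₀) + 1) * hι + ι * hu + ι * R2
  · linear_combination D * R1 + D * (σ φ₁ * φ₀) * hι
  · linear_combination R2 + D * (σ φ₁ * φ₁) * hι
  · linear_combination (ι * ι * (σ φ₁ * (φ₀ - u))) * hDi + ι * (σ φ₁ * φ₀) * hι + ι * R1
  · linear_combination (ι * ι * ((σ φ₀ - σ u) * (φ₀ - u))) * hDi + (ι * (σ u * u + σ φ₀ * φ₀) + 1) * hι + ι * hu + ι * R2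
  · linear_combination (ι * ι * ((σ φ₀ - σ u) * φ₁)) * hDi + ι * (σ φ₀ * φ₁) * hι + ι * R1
  · linear_combination (ι * ι * Di * (σ φ₀ * φ₀ - σ u * u)) * hι - (ι * ι * (σ φ₁ * φ₁)) * hDi + (ι * ι * Di) * R2 - (ι * ι * Di) * hu

/-! ## §3 `t₋` is `GL₃`-conjugate to the pattern `γ = ι(g, u)`: the explicit conjugator `Y = B⁻¹ C₃⁻¹` and its inverse -/

/-- **`Y · γ = t₋ · Y`** for `Y = (0 ι ι∕r; 1 0 −p∕r; 0 −D D∕r)` and `γ = (φ₀+φ₁p, 0, φ₁q; 0, u, 0; φ₁r, 0, φ₀−φ₁p)` (uses `p² + qr = D`, `2ι = 1`, `D·Di = 1`, `r·ri = 1`).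
[cite: Rogawski1990, §3.1 p. 19; §3.6 p. 31] -/
theorem twistConj_mul_pattern_eq {p q r D ι Di ri φ₀ φ₁ u : K} (hD : p * p + q * r = D) (hι : 2 * ι = 1) (hDi : D * Di = 1) (hri : r * ri = 1) :
    (!![(0 : K), ι, ι * ri; 1, 0, -(p * ri); 0, -D, D * ri] : Matrix (Fin 3) (Fin 3) K) *
        !![φ₀ + φ₁ * p, 0, φ₁ * q; 0, u, 0; φ₁ * r, 0, φ₀ - φ₁ * p] =
      !![(u + φ₀) * ι, φ₁ * ι, (φ₀ - u) * ι * ι * Di; φ₁ * D, φ₀, φ₁ * ι; D * (φ₀ - u), D * φ₁, (u + φ₀) * ι] *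
        !![(0 : K), ι, ι * ri; 1, 0, -(p * ri); 0, -D, D * ri] := by
  ext i j
  fin_cases i <;> fin_cases j <;> simp [Matrix.mul_apply, Fin.sum_univ_three]
  · linear_combination ι * φ₁ * hri
  · linear_combination (-(ι * u)) * hι + (ι * ι * (φ₀ - u)) * hDi
  · linear_combination (-(ι * ri * φ₀)) * hι - (ι * ι * ri * (φ₀ - u)) * hDi
  · linear_combination (-(p * φ₁)) * hri
  · ring
  · linear_combination (-(φ₁ * q)) * hri - (φ₁ * D * ri) * hι + (φ₁ * ri) * hD
  · linear_combination D * φ₁ * hri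
  · linear_combination D * u * hι
  · linear_combination (-(D * ri * φ₀)) * hι

/-- **`Y · Y⁻¹ = 1`** for `Y⁻¹ = (p 1 pι∕D; 1 0 −ι∕D; r 0 rι∕D)`. [cite: Rogawski1990, §3.1 p. 19] -/
theorem twistConj_mul_inv {p r D ι Di ri : K} (hι : 2 * ι = 1) (hDi : D * Di = 1) (hri : r * ri = 1) :
    (!![(0 : K), ι, ι * ri; 1, 0, -(p * ri); 0, -D, D * ri] : Matrix (Fin 3) (Fin 3) K) * !![p, 1, p * ι * Di; 1, 0, -(ι * Di); r, 0, r * ι * Di] = 1 := by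
  ext i j
  fin_cases i <;> fin_cases j <;> simp [Matrix.mul_apply, Fin.sum_univ_three]
  · linear_combination hι + ι * hri
  · linear_combination (ι * ι * Di) * hri
  · linear_combination (-p) * hri
  · linear_combination (-(p * ι * Di)) * hri
  · linear_combination D * hri
  · linear_combination (D * Di) * hι + hDi + (ι * D * Di) * hri

/-- **`Y⁻¹ · Y = 1`**. [cite: Rogawski1990, §3.1 p. 19] -/
theorem twistConjInv_mul {p r D ι Di ri : K} (hι : 2 * ι = 1) (hDi : D * Di = 1) (hri : r * ri = 1) :
    (!![p, 1, p * ι * Di; 1, 0, -(ι * Di); r, 0, r * ι * Di] : Matrix (Fin 3) (Fin 3) K) * !![(0 : K), ι, ι * ri; 1, 0, -(p * ri); 0, -D, D * ri] = 1 := by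
  ext i j
  fin_cases i <;> fin_cases j <;> simp [Matrix.mul_apply, Fin.sum_univ_three]
  · linear_combination (-(p * ι)) * hDi
  · linear_combination (p * ri) * hι + (p * ri * ι) * hDi
  · linear_combination hι + ι * hDi
  · linear_combination (-(ι * ri)) * hDi
  · linear_combination (-(r * ι)) * hDi
  · linear_combination (r * ri) * hι + hri + (ι * r * ri) * hDi

/-! ## §4 The twisted Gram matrix of `Y`: `ᵗ(σY) Φ₃ Y = Φ₃ · ι(Π∕r, −D) = (1 0 −p∕r; 0 −D 0; p∕r 0 q∕r)` — Cartan corner `−D` -/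

/-- **`ᵗ(σY) · Φ₃ · Y = (1 0 −p∕r; 0 −D 0; p∕r 0 q∕r)`** (`σp = −p`, `σ` fixes `D, ι, ri`; uses `p² + qr = D`, `2ι = 1`, `r·ri = 1`): the Cartan class of the stable conjugator `Y`
is `ι(Π∕r, −D)` with CORNER `−D`. [cite: Rogawski1990, §3.1 p. 19; §3.5 Prop. 3.5.2 (a) p. 29] -/
theorem twistConj_twistGram_eq {p q r D ι ri : K} (hp : σ p = -p) (hσD : σ D = D) (hσι : σ ι = ι) (hσri : σ ri = ri)
    (hD : p * p + q * r = D) (hι : 2 * ι = 1) (hri : r * ri = 1) :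
    ((!![(0 : K), ι, ι * ri; 1, 0, -(p * ri); 0, -D, D * ri] : Matrix (Fin 3) (Fin 3) K).map σ)ᵀ * !![(0 : K), 0, 1; 0, 1, 0; 1, 0, 0] *
        !![(0 : K), ι, ι * ri; 1, 0, -(p * ri); 0, -D, D * ri] =
      !![(1 : K), 0, -(p * ri); 0, -D, 0; p * ri, 0, q * ri] := by
  ext i j
  fin_cases i <;> fin_cases j <;> simp [Matrix.mul_apply, Fin.sum_univ_three, map_mul, map_neg, hp, hσD, hσι, hσri]
  · linear_combination (-D) * hι
  · ring
  · ring
  · linear_combination (D * ri * ri) * hι - (ri * ri) * hD + (q * ri) * hri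

/-! ## §5 A unitary conjugator from `γ` to `t₋` would make `−D` a norm -/

/-- **The centraliser of the pattern is block-diagonal**: if `z` commutes with `γ = (a 0 b; 0 u 0; c 0 d)` and `(a − u)(d − u) − bc ≠ 0` (`u` is not an eigenvalue of `g`), then
`z₀₁ = z₂₁ = 0`. [cite: Rogawski1990, §3.6 p. 31] -/
theorem apply_zero_one_eq_zero_of_commute_pattern {a b c d u : K} (hdet : (a - u) * (d - u) - b * c ≠ 0) {z : Matrix (Fin 3) (Fin 3) K}
    (hz : z * !![a, 0, b; 0, u, 0; c, 0, d] = !![a, 0, b; 0, u, 0; c, 0, d] * z) : z 0 1 = 0 ∧ z 2 1 = 0 := by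
  have h1 := congrArg (fun M => M 0 1) hz
  have h2 := congrArg (fun M => M 2 1) hz
  simp [Matrix.mul_apply, Fin.sum_univ_three] at h1 h2
  constructor
  · have h : ((a - u) * (d - u) - b * c) * z 0 1 = 0 := by linear_combination (-(d - u)) * h1 + b * h2
    rcases mul_eq_zero.1 h with h | h
    · exact absurd h hdet
    · exact h
  · have h : ((a - u) * (d - u) - b * c) * z 2 1 = 0 := by linear_combination c * h1 + (-(a - u)) * h2
    rcases mul_eq_zero.1 h with h | h
    · exact absurd h hdet
    · exact h

/-- **UNITARY CONJUGACY OF `γ` AND `t₋` FORCES `−D` TO BE A NORM.**  With all the frame hypotheses (`Π = (p q; r −p)`, `p² + qr = D`, `2ι = 1`, `D·Di = 1`, `r·ri = 1`, `σ` fixing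
`D, ι, Di, ri`, `σp = −p`) and `(a − u)(d − u) − bc ≠ 0` for `g = (a b; c d) = (φ₀+φ₁p, φ₁q; φ₁r, φ₀−φ₁p)`: if `h ∈ U(Φ₃)` (`ᵗ(σh)Φ₃h = Φ₃`) satisfies `h·γ = t₋·h`, then
`σ(y)·y = −D` for some `y` — `h = Y·z` with `z = Y⁻¹h ∈ Z(γ)`, `z₀₁ = z₂₁ = 0`, and the middle entry of `ᵗ(σz)·(ᵗ(σY)Φ₃Y)·z = Φ₃` is `−D·σ(z₁₁)·z₁₁ = 1`.
[cite: Rogawski1990, §3.5 Prop. 3.5.2 (a)(c) p. 29; §3.6 p. 31] -/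
theorem exists_norm_eq_neg_of_unitary_conj {p q r D ι Di ri φ₀ φ₁ u : K} (hp : σ p = -p) (hσD : σ D = D) (hσι : σ ι = ι)
    (hσri : σ ri = ri) (hD : p * p + q * r = D) (hι : 2 * ι = 1) (hDi : D * Di = 1) (hri : r * ri = 1)
    (hdet : (φ₀ + φ₁ * p - u) * (φ₀ - φ₁ * p - u) - φ₁ * q * (φ₁ * r) ≠ 0)
    {h : Matrix (Fin 3) (Fin 3) K} (hhU : (h.map σ)ᵀ * !![(0 : K), 0, 1; 0, 1, 0; 1, 0, 0] * h = !![(0 : K), 0, 1; 0, 1, 0; 1, 0, 0])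
    (hconj : h * !![φ₀ + φ₁ * p, 0, φ₁ * q; 0, u, 0; φ₁ * r, 0, φ₀ - φ₁ * p] =
      !![(u + φ₀) * ι, φ₁ * ι, (φ₀ - u) * ι * ι * Di; φ₁ * D, φ₀, φ₁ * ι; D * (φ₀ - u), D * φ₁, (u + φ₀) * ι] * h) :
    ∃ y : K, σ y * y = -D := by
  -- abbreviations (local names only)
  set Y : Matrix (Fin 3) (Fin 3) K := !![(0 : K), ι, ι * ri; 1, 0, -(p * ri); 0, -D, D * ri] with hYdef
  set Yi : Matrix (Fin 3) (Fin 3) K := !![p, 1, p * ι * Di; 1, 0, -(ι * Di); r, 0, r * ι * Di] with hYidef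
  set tp : Matrix (Fin 3) (Fin 3) K := !![φ₀ + φ₁ * p, 0, φ₁ * q; 0, u, 0; φ₁ * r, 0, φ₀ - φ₁ * p] with htpdef
  set tm : Matrix (Fin 3) (Fin 3) K :=
    !![(u + φ₀) * ι, φ₁ * ι, (φ₀ - u) * ι * ι * Di; φ₁ * D, φ₀, φ₁ * ι; D * (φ₀ - u), D * φ₁, (u + φ₀) * ι] with htmdef
  set Φ : Matrix (Fin 3) (Fin 3) K := !![(0 : K), 0, 1; 0, 1, 0; 1, 0, 0] with hΦdef
  have hYYi : Y * Yi = 1 := twistConj_mul_inv hι hDi hri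
  have hYiY : Yi * Y = 1 := twistConjInv_mul hι hDi hri
  have hYtp : Y * tp = tm * Y := twistConj_mul_pattern_eq hD hι hDi hri
  have hGram : (Y.map σ)ᵀ * Φ * Y = !![(1 : K), 0, -(p * ri); 0, -D, 0; p * ri, 0, q * ri] :=
    twistConj_twistGram_eq σ hp hσD hσι hσri hD hι hri
  -- `z = Y⁻¹ h` commutes with `γ`
  set z : Matrix (Fin 3) (Fin 3) K := Yi * h with hzdef
  have hYitm : Yi * tm = tp * Yi := by
    calc Yi * tm = Yi * tm * (Y * Yi) := by rw [hYYi, Matrix.mul_one]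
      _ = Yi * (tm * Y) * Yi := by simp only [Matrix.mul_assoc]
      _ = Yi * (Y * tp) * Yi := by rw [hYtp]
      _ = (Yi * Y) * tp * Yi := by simp only [Matrix.mul_assoc]
      _ = tp * Yi := by rw [hYiY, Matrix.one_mul]
  have hz : z * tp = tp * z := by
    calc z * tp = Yi * (h * tp) := by rw [hzdef, Matrix.mul_assoc]
      _ = Yi * (tm * h) := by rw [hconj]
      _ = (Yi * tm) * h := by rw [Matrix.mul_assoc]
      _ = tp * z := by rw [hYitm, hzdef, Matrix.mul_assoc]
  obtain ⟨h01, h21⟩ := apply_zero_one_eq_zero_of_commute_pattern hdet hz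
  -- `h = Y z`, so `ᵗ(σz) (ᵗ(σY) Φ Y) z = Φ`
  have hhYz : h = Y * z := by rw [hzdef, ← Matrix.mul_assoc, hYYi, Matrix.one_mul]
  have key : (z.map σ)ᵀ * !![(1 : K), 0, -(p * ri); 0, -D, 0; p * ri, 0, q * ri] * z = Φ := by
    rw [← hGram]
    have e : (h.map σ)ᵀ * Φ * h = (z.map σ)ᵀ * ((Y.map σ)ᵀ * Φ * Y) * z := by
      rw [hhYz, Matrix.map_mul, Matrix.transpose_mul]
      simp only [Matrix.mul_assoc]
    rw [← e]
    exact hhU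
  -- the middle entry: `−D σ(z₁₁) z₁₁ = 1`
  have e11 := congrArg (fun M => M 1 1) key
  simp [Matrix.mul_apply, Fin.sum_univ_three, h01, h21, hΦdef] at e11
  -- `e11 : σ (z 1 1) * (-D) * z 1 1 = 1` up to normal form
  have hN : σ (z 1 1) * z 1 1 * (-D) = 1 := by linear_combination e11
  have hz0 : z 1 1 ≠ 0 := by
    intro h0
    rw [h0, mul_zero, zero_mul] at hN
    exact zero_ne_one hN
  have hσz0 : σ (z 1 1) ≠ 0 := by
    intro h0
    rw [h0, zero_mul, zero_mul] at hN
    exact zero_ne_one hN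
  refine ⟨(z 1 1)⁻¹, ?_⟩
  rw [map_inv₀]
  have hprod : σ (z 1 1) * z 1 1 ≠ 0 := mul_ne_zero hσz0 hz0
  calc (σ (z 1 1))⁻¹ * (z 1 1)⁻¹ = (σ (z 1 1) * z 1 1)⁻¹ * 1 := by rw [mul_inv, mul_one]
    _ = (σ (z 1 1) * z 1 1)⁻¹ * (σ (z 1 1) * z 1 1 * (-D)) := by rw [hN]
    _ = -D := by rw [← mul_assoc, inv_mul_cancel₀ hprod, one_mul]

end Literature.NumberTheory.Rogawski1990
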